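/-
Copyright: the b2b-balaban cell (near-miss cell 7), T⁴-continuum fan-out, lineage t4-ne7b-p3 (node U5c LARGE-DEVIATION
member P3).  Released under the licence of the surrounding project.
-/
import Summits.QuantumFields.BalabanUV.T4Continuum.Support.SpaceTimeRealisedCells
import Summits.QuantumFields.BalabanUV.T4Continuum.Support.HistoryRealiseCells

/-!
# Space-time Peierls ∕ Cramér route for NE7b — THE OCCUPANCY OF A LINEAGE IN THE INDEX MODEL: occupied index sets
# per step, their count against the history tree's cells, and the vertical chain of a birth

Summits-side support leaf of the T⁴-continuum cell (rung (B)+1 on a FINITE torus only; NOT infinite volume, NOT the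
mass gap, NOT the Clay statement; NOT a proof of the spine estimate NE7b).  Lineage `t4-ne7b-p3` (generation 2), node
U5c, skeleton `t4/skeletons/NE7b-t4-ne7b-p3.md` §9–§11 (reading A2b «the contour's cells are the structure-steps'
realised domains» made a DEFINITION, and the chain behind `LineageReadings.cover`).  [folklore] finite combinatorics
over `SpaceTimeRealised{,Cells}` (`iterAt`, `dom`, `treeCells`, `Qs`, `coverAt`) and the COUNT member's
`HistoryRealiseCells.coarse_Qprod_mem_Siter` (lineage t4-ne7b-p1, BY NAME); nothing printed is asserted; no `[cite:]`
tag.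

WHAT.
* §1 `occAt q step piece G u` — THE OCCUPIED INDEX SET of the lineage `G` at step `u`: the realised domain `dom` of
  the structure alive at `u` (below a renewal ∕ merger step: the previous structure's, resp. the union of the two
  partners').  `sum_card_occAt_le_treeCells`: `Σ_{u<t} #occAt G u ≤ treeCells G t` (the history tree's cells, bounded
  by `SpaceTimeRealisedCells.treeCells_le` ∕ `SpaceTimeJunction.treeCells_le_of_realises`).
  `iterAt_subset_occAt`: under `SkelOK`, the S-iterate at step `u ≥ step b` of the piece of any event `b` of `G` is
  occupied at `u`.
* §2 THE VERTICAL CHAIN OF A BIRTH: `coverAt_subset_iterAt` (the re-blocked image of a piece lies in its S-iterate),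
  `chainPt q j y u := coarse (Qs q j u) y`, `chainPt_succ : coarse (q u) (chainPt u) = chainPt (u+1)`,
  `chainPt_mem_occAt`: for `y` in the piece of a birth `b` of `G` (step `j`), `chainPt q j y u ∈ occAt G u` for all
  `u ≥ j` — the index-model half of `LineageReadings.cover` (the torus half is `SpaceTimeTorusDict.nearT_toCell_coarse`).

HONEST DEPENDENCY (cell, verbatim): continuum YM on T⁴ ⇐ BetaPertH ∧ nine spine estimates (0/9 proved); BetaPertH ⇐
(D1) ∧ (D4) ∧ CAP+tail; G-an2-4 gates asym, D1 and NE2/3/4.  This file changes none of it.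
-/

open Finset

namespace Summit.QuantumFields.BalabanUV.T4Continuum.SpaceTimePeierls

open Literature.MathematicalPhysics.QuantumFieldTheory.Balaban1983to89
open Literature.MathematicalPhysics.QuantumFieldTheory.Balaban1983to89.B13ScaleTransfer
open Literature.MathematicalPhysics.QuantumFieldTheory.Balaban1983to89.B16SProfile
open T4PersistenceDictionary
open Summit.QuantumFields.BalabanUV.T4Continuum.HistoryRealiseCells (coarse_Qprod_mem_Siter)

noncomputable section

/-! ## §1 The occupied index set of a lineage at a step -/

section Occ

variable {d : ℕ} {ε : Type*} [DecidableEq ε]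

/-- **THE OCCUPIED INDEX SET** of the lineage `G` at step `u`: the realised domain of the structure alive at `u` —
for a birth at `j`, `dom` from `j` on (nothing before); for a renewal at `h + 1`, the renewed structure's `dom` from
`h + 1` on and the previous structure's occupied set before; for a merger at `step e`, the merged `dom` from `step e`
on and the union of the partners' occupied sets before. [folklore] -/
def occAt (q : ℕ → ℕ) (step : ε → ℕ) (piece : ε → Finset (Pt d)) : Gen ε → ℕ → Finset (Pt d)
  | Gen.born b j, u => if j ≤ u then dom q step piece (Gen.born b j) u else ∅
  | Gen.renew G e h, u => if h + 1 ≤ u then dom q step piece (Gen.renew G e h) u else occAt q step piece G u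
  | Gen.merge X Y e, u =>
      if step e ≤ u then dom q step piece (Gen.merge X Y e) u else occAt q step piece X u ∪ occAt q step piece Y u

variable {q : ℕ → ℕ} {step : ε → ℕ} {piece : ε → Finset (Pt d)}

/-- splitting a sum over `u < t` at a threshold `a`: the part below `min a t` and the part `a ≤ u < t` [folklore] -/
theorem sum_range_split (F : ℕ → ℝ) (a t : ℕ) :
    ∑ u ∈ range t, F u = ∑ u ∈ range (min a t), F u + ∑ u ∈ Ico a t, F u := by
  have h1 : Ico (min a t) t = Ico a t := by
    ext u
    simp only [mem_Ico]
    omega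
  rw [← sum_range_add_sum_Ico F (min_le_right a t), h1]

/-- **THE OCCUPIED SETS ARE COUNTED BY THE HISTORY TREE's CELLS**: `Σ_{u<t} #occAt G u ≤ treeCells G t`. [folklore] -/
theorem sum_card_occAt_le_treeCells :
    ∀ (G : Gen ε) (t : ℕ), ∑ u ∈ range t, ((occAt q step piece G u).card : ℝ) ≤ treeCells q step piece G t
  | Gen.born b j, t => by
      rw [sum_range_split _ j t, treeCells]
      have h0 : ∑ u ∈ range (min j t), ((occAt q step piece (Gen.born b j) u).card : ℝ) = 0 := by
        refine sum_eq_zero fun u hu => ?_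
        rw [mem_range] at hu
        simp [occAt, show ¬ j ≤ u by omega]
      have h1 : ∑ u ∈ Ico j t, ((occAt q step piece (Gen.born b j) u).card : ℝ) =
          ∑ u ∈ Ico j t, ((dom q step piece (Gen.born b j) u).card : ℝ) := by
        refine sum_congr rfl fun u hu => ?_
        rw [mem_Ico] at hu
        simp [occAt, hu.1]
      rw [h0, h1, zero_add]
  | Gen.renew G e h, t => by
      rw [sum_range_split _ (h + 1) t, treeCells]
      have IH := sum_card_occAt_le_treeCells G (min (h + 1) t)
      have h0 : ∑ u ∈ range (min (h + 1) t), ((occAt q step piece (Gen.renew G e h) u).card : ℝ) =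
          ∑ u ∈ range (min (h + 1) t), ((occAt q step piece G u).card : ℝ) := by
        refine sum_congr rfl fun u hu => ?_
        rw [mem_range] at hu
        simp [occAt, show ¬ h + 1 ≤ u by omega]
      have h1 : ∑ u ∈ Ico (h + 1) t, ((occAt q step piece (Gen.renew G e h) u).card : ℝ) =
          ∑ u ∈ Ico (h + 1) t, ((dom q step piece (Gen.renew G e h) u).card : ℝ) := by
        refine sum_congr rfl fun u hu => ?_
        rw [mem_Ico] at hu
        simp [occAt, hu.1]
      rw [h0, h1]
      linarith
  | Gen.merge X Y e, t => by
      rw [sum_range_split _ (step e) t, treeCells]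
      have IHX := sum_card_occAt_le_treeCells X (min (step e) t)
      have IHY := sum_card_occAt_le_treeCells Y (min (step e) t)
      have h0 : ∑ u ∈ range (min (step e) t), ((occAt q step piece (Gen.merge X Y e) u).card : ℝ) ≤
          ∑ u ∈ range (min (step e) t), ((occAt q step piece X u).card : ℝ) +
            ∑ u ∈ range (min (step e) t), ((occAt q step piece Y u).card : ℝ) := by
        rw [← sum_add_distrib]
        refine sum_le_sum fun u hu => ?_
        rw [mem_range] at hu
        simp only [occAt, show ¬ step e ≤ u by omega, if_false]
        exact_mod_cast card_union_le _ _
      have h1 : ∑ u ∈ Ico (step e) t, ((occAt q step piece (Gen.merge X Y e) u).card : ℝ) =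
          ∑ u ∈ Ico (step e) t, ((dom q step piece (Gen.merge X Y e) u).card : ℝ) := by
        refine sum_congr rfl fun u hu => ?_
        rw [mem_Ico] at hu
        simp [occAt, hu.1]
      rw [h1]
      linarith

variable {fat : ε → ℕ} {dC : ℝ}

/-- the S-iterate of an event's piece is part of the realised domain of any structure containing the event
[folklore] -/
theorem iterAt_subset_dom {G : Gen ε} {b : ε} (hb : b ∈ G.events) (u : ℕ) :
    iterAt q (step b) u (piece b) ⊆ dom q step piece G u :=
  subset_biUnion_of_mem (fun e => iterAt q (step e) u (piece e)) hb

/-- **EVERY EVENT's ITERATED PIECE IS OCCUPIED**: under `SkelOK`, for an event `b` of `G` and a step `u ≥ step b`,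
`iterAt q (step b) u (piece b) ⊆ occAt G u`. [folklore] -/
theorem iterAt_subset_occAt :
    ∀ {G : Gen ε}, SkelOK q step piece fat dC G → ∀ {b : ε}, b ∈ G.events → ∀ {u : ℕ}, step b ≤ u →
      iterAt q (step b) u (piece b) ⊆ occAt q step piece G u
  | Gen.born b' j, hok, b, hb, u, hu => by
      rw [Gen.events_born, mem_singleton] at hb
      subst hb
      have hj : step b = j := hok.1
      simp only [occAt, show j ≤ u by omega, if_true]
      exact iterAt_subset_dom (by simp) u
  | Gen.renew G e h, hok, b, hb, u, hu => by
      obtain ⟨hG, hpe, hse, -⟩ := hok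
      by_cases hcase : h + 1 ≤ u
      · simp only [occAt, hcase, if_true]
        exact iterAt_subset_dom hb u
      · simp only [occAt, hcase, if_false]
        rw [Gen.events_renew, mem_insert] at hb
        rcases hb with rfl | hb
        · rw [hpe, iterAt, Siter_empty]
          exact empty_subset _
        · exact iterAt_subset_occAt hG hb hu
  | Gen.merge X Y e, hok, b, hb, u, hu => by
      obtain ⟨hX, hY, -, -, -⟩ := hok
      by_cases hcase : step e ≤ u
      · simp only [occAt, hcase, if_true]
        exact iterAt_subset_dom hb u
      · simp only [occAt, hcase, if_false]
        rw [Gen.events_merge, mem_insert, mem_union] at hb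
        rcases hb with rfl | hb | hb
        · exact absurd hu hcase
        · exact (iterAt_subset_occAt hX hb hu).trans subset_union_left
        · exact (iterAt_subset_occAt hY hb hu).trans subset_union_right

end Occ

/-! ## §2 The vertical chain of a birth in the index model -/

section Chain

variable {d : ℕ}

/-- **THE RE-BLOCKED IMAGE OF A PIECE LIES IN ITS S-ITERATE**: `coverAt q s n Z ⊆ iterAt q s n Z`
(`coarse_Qprod_mem_Siter` along the ratios from `s` on). [folklore] -/
theorem coverAt_subset_iterAt (q : ℕ → ℕ) (s n : ℕ) (Z : Finset (Pt d)) : coverAt q s n Z ⊆ iterAt q s n Z := by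
  intro y hy
  obtain ⟨x, hx, rfl⟩ := mem_image.1 hy
  exact coarse_Qprod_mem_Siter _ hx _

/-- **THE CHAIN POINT** at step `u` of an index point `y` created at step `j`: its `Qs q j u`-block. [folklore] -/
def chainPt (q : ℕ → ℕ) (j : ℕ) (y : Pt d) (u : ℕ) : Pt d := coarse (Qs q j u) y

/-- the chain starts at `y` [folklore] -/
@[simp] theorem chainPt_self (q : ℕ → ℕ) (j : ℕ) (y : Pt d) : chainPt q j y j = y := by
  simp [chainPt, coarse_one]

/-- **CONSECUTIVE CHAIN POINTS ARE BLOCK AND SUB-BLOCK**: `coarse (q u) (chainPt u) = chainPt (u + 1)` (`u ≥ j`).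
[folklore] -/
theorem chainPt_succ (q : ℕ → ℕ) {j u : ℕ} (hu : j ≤ u) (y : Pt d) :
    coarse (q u) (chainPt q j y u) = chainPt q j y (u + 1) := by
  rw [chainPt, chainPt, coarse_coarse, Qs_succ q hu]

/-- the chain point lies in the re-blocked image of any index set containing `y` [folklore] -/
theorem chainPt_mem_coverAt (q : ℕ → ℕ) (j u : ℕ) {Z : Finset (Pt d)} {y : Pt d} (hy : y ∈ Z) :
    chainPt q j y u ∈ coverAt q j u Z :=
  mem_image_of_mem _ hy

variable {ε : Type*} [DecidableEq ε] {q : ℕ → ℕ} {step : ε → ℕ} {piece : ε → Finset (Pt d)} {fat : ε → ℕ} {dC : ℝ}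

/-- **THE VERTICAL CHAIN OF A BIRTH IS OCCUPIED**: under `SkelOK`, for an event `b` of `G` and `y ∈ piece b`, the
chain point `chainPt q (step b) y u` is occupied at every step `u ≥ step b`. [folklore] -/
theorem chainPt_mem_occAt {G : Gen ε} (hok : SkelOK q step piece fat dC G) {b : ε} (hb : b ∈ G.events) {y : Pt d}
    (hy : y ∈ piece b) {u : ℕ} (hu : step b ≤ u) : chainPt q (step b) y u ∈ occAt q step piece G u :=
  iterAt_subset_occAt hok hb hu (coverAt_subset_iterAt q (step b) u (piece b) (chainPt_mem_coverAt q _ u hy))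

end Chain

end

end Summit.QuantumFields.BalabanUV.T4Continuum.SpaceTimePeierls
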